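import Mathlib
import Literature.NumberTheory.Transcendental.KZCalculus
import Literature.NumberTheory.Transcendental.SemialgebraicLineDeriv

/-!
# `GenusTwoCycleTransfer`, line `separating-pencil-trace`: the one-dimensional rule-2 push-forward

Stub `stub_pushforwardDimOne` of the crux `GenusTwoCycleTransfer` (stmt-KontsevichZagierPeriods-3408,
route HermiteRigidity). Given a KZ integral representation `r = [σ, f]` in dimension `1`, a function
`φ : ℝ → ℝ` which on `σ` is `ℚ`-semialgebraic with a `ℚ`-semialgebraic nowhere-vanishing
derivative `φ'`, and a `ℚ`-semialgebraic left inverse `G` of `Φ : p ↦ (φ (p 0))` on the image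
`Φ σ`, we BUILD the pushed-forward representation `s = [Φ σ, (f / |φ'|) ∘ G]`:

* the image `Φ σ` is `ℚ`-semialgebraic (Tarski–Seidenberg, `IsSemialgebraicMapOn.isSemialgebraic_image_holds`);
* the integrand `(f · |φ'|⁻¹) ∘ G` is `ℚ`-semialgebraic on it (closure of semialgebraic functions
  under `|·|`, `⁻¹`, `·` and composition with a semialgebraic map);
* it is integrable on `Φ σ` by Mathlib's change-of-variables criterion
  `MeasureTheory.integrableOn_image_iff_integrableOn_abs_det_fderiv_smul`, the pulled-back integrand
  `|det DΦ| · (f/|φ'|) ∘ G ∘ Φ` being `f` itself on `σ` (`DΦ = φ' • id`, `det DΦ = φ'` on `ℝ¹`);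

and exhibit `[r] − [s]` as ONE element of `KZ.changeOfVariablesRel` (Kontsevich–Zagier's rule (2)).

References: M. Kontsevich, D. Zagier, *Periods* (2001), §1.2 rule (2); J. Bochnak, M. Coste,
M.-F. Roy, *Real Algebraic Geometry* (1998), §2.2.
-/

noncomputable section

open Set MeasureTheory
open Literature.NumberTheory.Transcendental Literature.ModelTheory.ExponentialFields

namespace Summit.KontsevichZagierPeriods.HermiteRigidity.GenusTwoCycleTransfer

/-- On `ℝ¹ = Fin 1 → ℝ` the scalar map `c • id` has determinant `c`. [folklore] -/
theorem det_smul_id_fin_one (c : ℝ) :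
    (c • ContinuousLinearMap.id ℝ (Fin 1 → ℝ)).det = c := by
  rw [ContinuousLinearMap.det, ContinuousLinearMap.toLinearMap_smul, ContinuousLinearMap.coe_id,
    LinearMap.det_smul, LinearMap.det_id, Module.finrank_fintype_fun_eq_card, Fintype.card_fin]
  ring

/-- The map `Φ : p ↦ (φ (p 0))` of `ℝ¹` has derivative `φ'(p 0) • id` at `p` when `φ` has
derivative `φ'(p 0)` at `p 0` (chain rule with the coordinate projection). [folklore] -/
theorem hasFDerivAt_fin_one (φ : ℝ → ℝ) (c : ℝ) (p : Fin 1 → ℝ) (h : HasDerivAt φ c (p 0)) :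
    HasFDerivAt (fun q : Fin 1 → ℝ => fun _ : Fin 1 => φ (q 0))
      (c • ContinuousLinearMap.id ℝ (Fin 1 → ℝ)) p := by
  have h0 : HasFDerivAt (fun q : Fin 1 → ℝ => q 0)
      (ContinuousLinearMap.proj (R := ℝ) (φ := fun _ : Fin 1 => ℝ) 0) p :=
    hasFDerivAt_apply (𝕜 := ℝ) 0 p
  have h1 := HasDerivAt.comp_hasFDerivAt p h h0
  have h2 : HasFDerivAt (fun (q : Fin 1 → ℝ) (_ : Fin 1) => (φ ∘ fun q : Fin 1 → ℝ => q 0) q)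
      (ContinuousLinearMap.pi fun _ : Fin 1 => c • ContinuousLinearMap.proj (R := ℝ)
        (φ := fun _ : Fin 1 => ℝ) 0) p :=
    hasFDerivAt_pi.mpr fun _ => h1
  refine h2.congr_fderiv ?_
  ext v i
  simp [Fin.fin_one_eq_zero i]

/-- **Stub `stub_pushforwardDimOne`** (line `separating-pencil-trace` of `GenusTwoCycleTransfer`):
the one-dimensional rule-2 push-forward. If `φ` is `ℚ`-semialgebraic on the domain `σ` of
`r : KZ.IntegralRep 1`, with a `ℚ`-semialgebraic nowhere-zero derivative `φ'` there, and `G` is a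
`ℚ`-semialgebraic left inverse of `Φ : p ↦ (φ (p 0))` on `Φ σ`, then there is a representation `s`
with domain `Φ σ` and integrand `(r.integrand / |φ'|) ∘ G`, and `[r] − [s] ∈ KZ.changeOfVariablesRel`.
[cite: KontsevichZagier2001, §1.2 rule (2)] -/
theorem stub_pushforwardDimOne (r : KZ.IntegralRep 1) (φ φ' : ℝ → ℝ) (G : (Fin 1 → ℝ) → (Fin 1 → ℝ)) (hφ : IsSemialgebraicFunOn ℚ r.domain (fun p => φ (p 0))) (hφ' : IsSemialgebraicFunOn ℚ r.domain (fun p => φ' (p 0))) (hder : ∀ p ∈ r.domain, HasDerivAt φ (φ' (p 0)) (p 0)) (hne : ∀ p ∈ r.domain, φ' (p 0) ≠ 0) (hG : IsSemialgebraicMapOn ℚ ((fun p : Fin 1 → ℝ => fun _ : Fin 1 => φ (p 0)) '' r.domain) G) (hGφ : ∀ p ∈ r.domain, G (fun _ => φ (p 0)) = p) : ∃ s : KZ.IntegralRep 1, s.domain = (fun p : Fin 1 → ℝ => fun _ : Fin 1 => φ (p 0)) '' r.domain ∧ (∀ p ∈ r.domain, s.integrand (fun _ => φ (p 0)) = r.integrand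 p / |φ' (p 0)|) ∧ KZ.of r - KZ.of s ∈ KZ.changeOfVariablesRel := by
  set Φ : (Fin 1 → ℝ) → (Fin 1 → ℝ) := fun p _ => φ (p 0) with hΦ_def
  set Φ' : (Fin 1 → ℝ) → ((Fin 1 → ℝ) →L[ℝ] (Fin 1 → ℝ)) :=
    fun p => φ' (p 0) • ContinuousLinearMap.id ℝ (Fin 1 → ℝ) with hΦ'_def
  have hmeas : MeasurableSet r.domain := KZ.IntegralRep.measurableSet_domain_holds r
  have hσ : IsSemialgebraic ℚ r.domain := r.isSemialgebraic_domain
  -- Φ is a semialgebraic map, injective on σ, with derivative Φ' within σ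
  have hΦsa : IsSemialgebraicMapOn ℚ r.domain Φ := IsSemialgebraicMapOn.of_forall hσ fun _ => hφ
  have hinj : InjOn Φ r.domain := by
    intro p hp p' hp' h
    have := congrArg G h
    rwa [hGφ p hp, hGφ p' hp'] at this
  have hderiv : ∀ p ∈ r.domain, HasFDerivWithinAt Φ (Φ' p) r.domain p := fun p hp =>
    (hasFDerivAt_fin_one φ (φ' (p 0)) p (hder p hp)).hasFDerivWithinAt
  have hdet : ∀ p, (Φ' p).det = φ' (p 0) := fun p => det_smul_id_fin_one (φ' (p 0))
  -- the image is semialgebraic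
  have hT : IsSemialgebraic ℚ (Φ '' r.domain) :=
    IsSemialgebraicMapOn.isSemialgebraic_image_holds hΦsa subset_rfl hσ
  -- the pushed-forward integrand
  set h : (Fin 1 → ℝ) → ℝ := fun p => r.integrand p * (|φ' (p 0)|)⁻¹ with hh_def
  have hh : IsSemialgebraicFunOn ℚ r.domain h :=
    r.isSemialgebraicFunOn_integrand.fun_mul (hφ'.abs).fun_inv
  have hmaps : MapsTo G (Φ '' r.domain) r.domain := by
    rintro _ ⟨p, hp, rfl⟩
    rw [hGφ p hp]
    exact hp
  have hg : IsSemialgebraicFunOn ℚ (Φ '' r.domain) (h ∘ G) :=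
    IsSemialgebraicFunOn.comp_isSemialgebraicMapOn_holds hh hG hmaps
  have hgΦ : ∀ p ∈ r.domain, (h ∘ G) (Φ p) = r.integrand p * (|φ' (p 0)|)⁻¹ := fun p hp => by
    simp only [Function.comp_apply, hΦ_def, hGφ p hp, hh_def]
  -- the Jacobian identity on σ
  have hjac : ∀ p ∈ r.domain, r.integrand p = (h ∘ G) (Φ p) * |(Φ' p).det| := fun p hp => by
    rw [hgΦ p hp, hdet p, mul_assoc, inv_mul_cancel₀ (abs_ne_zero.mpr (hne p hp)), mul_one]
  -- integrability on the image (change of variables)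
  have hint : IntegrableOn (h ∘ G) (Φ '' r.domain) := by
    rw [integrableOn_image_iff_integrableOn_abs_det_fderiv_smul volume hmeas hderiv hinj]
    refine r.integrableOn.congr_fun (fun p hp => ?_) hmeas
    rw [smul_eq_mul, mul_comm]
    exact hjac p hp
  refine ⟨⟨Φ '' r.domain, h ∘ G, hT, hg, hint⟩, rfl, fun p hp => ?_, ?_⟩
  · show (h ∘ G) (Φ p) = r.integrand p / |φ' (p 0)|
    rw [hgΦ p hp, div_eq_mul_inv]
  · exact ⟨1, r, _, Φ, Φ', hΦsa, hderiv, hinj, rfl, hjac, rfl⟩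

end Summit.KontsevichZagierPeriods.HermiteRigidity.GenusTwoCycleTransfer

end
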